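import Summits.Ventures.Crystal3D.Bulk.GapFaceCorners
import Literature.Geometry.DiscreteGeometry.SphericalCodeHullVertexLink
import HarnessLib

/-!
# A consistently ORIENTED rotation system for the two-level tight map (handedness of the
# tangent frames), the oriented face successor and the oriented corner variables
# (`phase2/LEAN-FACES-DESIGN.md` (F1), erratum of 2026-08-23T04:0xZ)

HONEST FRAMING. Part of the venture `Summits/Ventures/Crystal3D` (cell `pub-crystal3d`, phase 2;
seat typer-bulk-2). The vertex rotation `nextNbr` of `Bulk/GapDarts.lean` sorts the tight
partners of each ball `i` by their azimuth in the tree's tangent frame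
`tangentFrame (gapDir c i)` (`Literature…SphericalCodeVertexStar`), which is `Classical.choose`
of SOME orthonormal frame with third vector `gapDir c i`: its HANDEDNESS
`det(frame) = ±1` is unspecified and may differ from vertex to vertex (the Literature carries
this sign explicitly, `orient3_polar`). Per-vertex statements (gaps, R-sum, gap `=` corner,
gaps `< π`) do not see the handedness, but the orbits of `faceSucc = σ ∘ α` are the FACES of the
drawn tight map only for a rotation system that turns the same way at every vertex. THIS file
supplies that rotation system:

* `frameDet c i` — the determinant of the frame at `gapDir c i` (`frameDet_sq : (·)² = 1`,
  `frameDet_eq_one_or`); `IsGapConfig.orient3_gapDir` — the tree's product formula in the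
  cell's vocabulary: `orient3 (u_i) (u_j) (u_k) = r_j r_k · sin(θ_k − θ_j) · frameDet c i`
  (`θ = tightAzimuth c i ·`, `r = trad`);
* `prevNbr c i j` (the azimuth-PREVIOUS partner; `prevNbr_tightNbrAt`,
  `IsGapConfig.nextNbr_prevNbr` / `prevNbr_nextNbr`);
* **`onextNbr c i j`** — the ORIENTED rotation: `nextNbr` if `frameDet c i = 1`, `prevNbr`
  otherwise, i.e. the counter-clockwise successor of the arc `i → j` seen from outside the unit
  sphere of directions, the SAME convention at all thirteen vertices; `oprevNbr`;
  `IsGapConfig.onextNbr_mem`, `onextNbr_oprevNbr`, `oprevNbr_onextNbr`, `onextNbr_ne_self`;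
* **`IsGapConfig.orient3_onextNbr_pos`** (the consistency theorem): whenever the gap from `j`
  to `onextNbr c i j` is `< π`, `orient3 (u_i) (u_j) (u_{onextNbr}) > 0` — the successor lies on
  the POSITIVE side of the plane through `u_i, u_j`, an orientation statement free of frames;
* `odartGap c i j` (the gap from the arc `i → j` to the arc `i → onextNbr c i j`) with the
  per-vertex rows re-proved: `odartGap_pos`, `odartGap_le_two_pi`, `IsGapConfig.sum_odartGap`
  (`Σ = 2π`), `IsGapConfig.odartGap_eq_corner`, `CensusRows.odartGap_lt_pi`,
  `CensusRows.odartGap_eq_corner`, `CensusRows.onextNbr_mem_ne`.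

The oriented face successor / face corners are the sequel `Bulk/GapOrientedDarts.lean`. Nothing is
claimed about GAP(1.26); the oriented faces and Euler's formula are NOT here.
-/

noncomputable section

open scoped BigOperators InnerProductSpace RealInnerProductSpace
open Finset Real

namespace Summit.Ventures.Crystal3D

open Literature.Geometry.DiscreteGeometry

variable {c : Fin 14 → EuclideanSpace ℝ (Fin 3)}

/-! ## Handedness of the tangent frame at a vertex -/

/-- **The handedness of the tangent frame at ball `i`**: the determinant
`orient3 b₀ b₁ b₂` of the tree's frame `tangentFrame (gapDir c i)` (third vector `gapDir c i`),
`= ±1`; junk value `1` if `gapDir c i` is not a unit vector. -/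
def frameDet (c : Fin 14 → EuclideanSpace ℝ (Fin 3)) (i : Fin 14) : ℝ :=
  if h : ‖gapDir c i‖ = 1 then
    orient3 (tangentFrame (gapDir c i) h 0) (tangentFrame (gapDir c i) h 1)
      (tangentFrame (gapDir c i) h 2)
  else 1

/-- Unfolding `frameDet` at a unit direction. -/
theorem frameDet_eq {i : Fin 14} (h : ‖gapDir c i‖ = 1) :
    frameDet c i = orient3 (tangentFrame (gapDir c i) h 0) (tangentFrame (gapDir c i) h 1)
      (tangentFrame (gapDir c i) h 2) := by
  unfold frameDet
  rw [dif_pos h]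

/-- `frameDet² = 1`. -/
theorem frameDet_sq (c : Fin 14 → EuclideanSpace ℝ (Fin 3)) (i : Fin 14) : frameDet c i ^ 2 = 1 := by
  unfold frameDet
  split_ifs with h
  · exact orient3_orthonormalBasis_sq _
  · norm_num

/-- `frameDet = 1` or `frameDet = −1`. -/
theorem frameDet_eq_one_or (c : Fin 14 → EuclideanSpace ℝ (Fin 3)) (i : Fin 14) :
    frameDet c i = 1 ∨ frameDet c i = -1 := by
  have h := frameDet_sq c i
  have h' : (frameDet c i - 1) * (frameDet c i + 1) = 0 := by nlinarith [h]
  rcases mul_eq_zero.1 h' with h1 | h1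
  · exact Or.inl (by linarith)
  · exact Or.inr (by linarith)

/-- If `frameDet ≠ 1` then `frameDet = −1`. -/
theorem frameDet_eq_neg_one_of_ne {i : Fin 14} (h : frameDet c i ≠ 1) : frameDet c i = -1 :=
  (frameDet_eq_one_or c i).resolve_left h

/-- **The product formula in the cell's vocabulary**: for an admissible configuration and balls
`i, j, k ≠ 0`,
`orient3 (gapDir c i) (gapDir c j) (gapDir c k) = trad · trad · sin(θ_k − θ_j) · frameDet c i`
with `θ = tightAzimuth c i ·` and `trad y u = √(1 − ⟪y, u⟫²)` (tree `orient3_polar`). -/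
theorem IsGapConfig.orient3_gapDir (hc : IsGapConfig c) {i j k : Fin 14} (hi0 : i ≠ 0) (hj0 : j ≠ 0)
    (hk0 : k ≠ 0) :
    orient3 (gapDir c i) (gapDir c j) (gapDir c k) =
      trad (gapDir c i) (gapDir c j) * trad (gapDir c i) (gapDir c k) *
        Real.sin (tightAzimuth c i k - tightAzimuth c i j) * frameDet c i := by
  have hi := hc.norm_gapDir hi0
  have hpj := polarRep_azimuth (y := gapDir c i) (hy := hi) (hc.norm_gapDir hj0)
  have hpk := polarRep_azimuth (y := gapDir c i) (hy := hi) (hc.norm_gapDir hk0)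
  have h := orient3_polar hpj hpk
  rw [tangentFrame_two] at h
  rw [hc.tightAzimuth_eq hi0, hc.tightAzimuth_eq hi0, frameDet_eq hi, tangentFrame_two]
  exact h

/-- The tangential radius of a tight partner is positive (window `D < 2`). -/
theorem IsGapConfig.trad_pos (hc : IsGapConfig c) (hD : intruderDist c < 2) {i j : Fin 14}
    (hi0 : i ≠ 0) (hj : j ∈ tightNbrs c i) : 0 < trad (gapDir c i) (gapDir c j) := by
  unfold trad
  exact Real.sqrt_pos.2 (by linarith [hc.sq_inner_gapDir_lt_one hD hi0 hj])

/-! ## The azimuth-previous partner -/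

/-- **The previous tight partner of `i` before `j`** in the azimuth order at `i` (the inverse of
the rotation `nextNbr c i`); `j` itself if `j` is not a partner. -/
def prevNbr (c : Fin 14 → EuclideanSpace ℝ (Fin 3)) (i j : Fin 14) : Fin 14 :=
  if h : ∃ m : Fin (tightAngles c i).card, tightNbrAt c i rfl m = j then
    tightNbrAt c i rfl ((finRotate _).symm (Classical.choose h))
  else j

/-- Unfolding `prevNbr` at a partner in position `m`. -/
theorem prevNbr_eq_of_tightNbrAt {i : Fin 14} (m : Fin (tightAngles c i).card) :
    prevNbr c i (tightNbrAt c i rfl m) =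
      tightNbrAt c i rfl ((finRotate (tightAngles c i).card).symm m) := by
  have h : ∃ m' : Fin (tightAngles c i).card, tightNbrAt c i rfl m' = tightNbrAt c i rfl m :=
    ⟨m, rfl⟩
  unfold prevNbr
  rw [dif_pos h]
  have hm : Classical.choose h = m := tightNbrAt_injective c i rfl (Classical.choose_spec h)
  rw [hm]

/-- `Fin.cast` commutes with the inverse rotation. -/
theorem cast_finRotate_symm {n n' : ℕ} (h : n = n') (m : Fin n) :
    Fin.cast h ((finRotate n).symm m) = (finRotate n').symm (Fin.cast h m) := by
  subst h
  rfl

/-- **The previous partner is at the previous position**, for any presentation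
`hd : #tightAngles = k + 1`. -/
theorem prevNbr_tightNbrAt {i : Fin 14} {k : ℕ} (hd : (tightAngles c i).card = k + 1)
    (m : Fin (k + 1)) :
    prevNbr c i (tightNbrAt c i hd m) = tightNbrAt c i hd ((finRotate (k + 1)).symm m) := by
  rw [tightNbrAt_cast i hd rfl m, prevNbr_eq_of_tightNbrAt, tightNbrAt_cast i rfl hd,
    cast_finRotate_symm]
  rfl

/-- `nextNbr ∘ prevNbr = id` on the tight partners (admissible, `D² < 3`). -/
theorem IsGapConfig.nextNbr_prevNbr (hc : IsGapConfig c) (hD3 : intruderDist c ^ 2 < 3)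
    {i j : Fin 14} (hi0 : i ≠ 0) (hj : j ∈ tightNbrs c i) : nextNbr c i (prevNbr c i j) = j := by
  obtain ⟨k, hd⟩ := hc.exists_card_tightAngles_eq_succ hD3 hi0 ⟨j, hj⟩
  obtain ⟨m, rfl⟩ := hc.exists_tightNbrAt_eq hD3 hi0 hd hj
  rw [prevNbr_tightNbrAt, nextNbr_tightNbrAt, Equiv.apply_symm_apply]

/-- `prevNbr ∘ nextNbr = id` on the tight partners (admissible, `D² < 3`). -/
theorem IsGapConfig.prevNbr_nextNbr (hc : IsGapConfig c) (hD3 : intruderDist c ^ 2 < 3)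
    {i j : Fin 14} (hi0 : i ≠ 0) (hj : j ∈ tightNbrs c i) : prevNbr c i (nextNbr c i j) = j := by
  obtain ⟨k, hd⟩ := hc.exists_card_tightAngles_eq_succ hD3 hi0 ⟨j, hj⟩
  obtain ⟨m, rfl⟩ := hc.exists_tightNbrAt_eq hD3 hi0 hd hj
  rw [nextNbr_tightNbrAt, prevNbr_tightNbrAt, Equiv.symm_apply_apply]

/-- The previous partner is a tight partner (admissible, `D² < 3`). -/
theorem IsGapConfig.prevNbr_mem (hc : IsGapConfig c) (hD3 : intruderDist c ^ 2 < 3)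
    {i j : Fin 14} (hi0 : i ≠ 0) (hj : j ∈ tightNbrs c i) : prevNbr c i j ∈ tightNbrs c i := by
  obtain ⟨k, hd⟩ := hc.exists_card_tightAngles_eq_succ hD3 hi0 ⟨j, hj⟩
  obtain ⟨m, rfl⟩ := hc.exists_tightNbrAt_eq hD3 hi0 hd hj
  rw [prevNbr_tightNbrAt]
  exact tightNbrAt_mem c i hd _

/-! ## The oriented rotation -/

/-- **The oriented successor**: the tight partner of `i` following `j` COUNTER-CLOCKWISE as seen
from outside the sphere of directions — `nextNbr` if the frame at `i` is right-handed
(`frameDet c i = 1`), `prevNbr` otherwise. The same convention at every vertex. -/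
def onextNbr (c : Fin 14 → EuclideanSpace ℝ (Fin 3)) (i j : Fin 14) : Fin 14 :=
  if frameDet c i = 1 then nextNbr c i j else prevNbr c i j

/-- **The oriented predecessor** (clockwise successor). -/
def oprevNbr (c : Fin 14 → EuclideanSpace ℝ (Fin 3)) (i j : Fin 14) : Fin 14 :=
  if frameDet c i = 1 then prevNbr c i j else nextNbr c i j

/-- The oriented successor is a tight partner (admissible, `D² < 3`). -/
theorem IsGapConfig.onextNbr_mem (hc : IsGapConfig c) (hD3 : intruderDist c ^ 2 < 3)
    {i j : Fin 14} (hi0 : i ≠ 0) (hj : j ∈ tightNbrs c i) : onextNbr c i j ∈ tightNbrs c i := by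
  unfold onextNbr
  split_ifs
  · exact hc.nextNbr_mem_tightNbrs hD3 hi0 hj
  · exact hc.prevNbr_mem hD3 hi0 hj

/-- The oriented predecessor is a tight partner (admissible, `D² < 3`). -/
theorem IsGapConfig.oprevNbr_mem (hc : IsGapConfig c) (hD3 : intruderDist c ^ 2 < 3)
    {i j : Fin 14} (hi0 : i ≠ 0) (hj : j ∈ tightNbrs c i) : oprevNbr c i j ∈ tightNbrs c i := by
  unfold oprevNbr
  split_ifs
  · exact hc.prevNbr_mem hD3 hi0 hj
  · exact hc.nextNbr_mem_tightNbrs hD3 hi0 hj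

/-- `onextNbr ∘ oprevNbr = id` on the tight partners. -/
theorem IsGapConfig.onextNbr_oprevNbr (hc : IsGapConfig c) (hD3 : intruderDist c ^ 2 < 3)
    {i j : Fin 14} (hi0 : i ≠ 0) (hj : j ∈ tightNbrs c i) : onextNbr c i (oprevNbr c i j) = j := by
  unfold onextNbr oprevNbr
  split_ifs
  · exact hc.nextNbr_prevNbr hD3 hi0 hj
  · exact hc.prevNbr_nextNbr hD3 hi0 hj

/-- `oprevNbr ∘ onextNbr = id` on the tight partners. -/
theorem IsGapConfig.oprevNbr_onextNbr (hc : IsGapConfig c) (hD3 : intruderDist c ^ 2 < 3)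
    {i j : Fin 14} (hi0 : i ≠ 0) (hj : j ∈ tightNbrs c i) : oprevNbr c i (onextNbr c i j) = j := by
  unfold onextNbr oprevNbr
  split_ifs
  · exact hc.prevNbr_nextNbr hD3 hi0 hj
  · exact hc.nextNbr_prevNbr hD3 hi0 hj

/-- The oriented successor is injective on the tight partners. -/
theorem IsGapConfig.onextNbr_injOn (hc : IsGapConfig c) (hD3 : intruderDist c ^ 2 < 3)
    {i : Fin 14} (hi0 : i ≠ 0) : Set.InjOn (onextNbr c i) (tightNbrs c i : Set (Fin 14)) := by
  intro j hj j' hj' h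
  rw [Finset.mem_coe] at hj hj'
  rw [← hc.oprevNbr_onextNbr hD3 hi0 hj, ← hc.oprevNbr_onextNbr hD3 hi0 hj', h]

/-- With at least two tight partners the oriented successor is a different partner. -/
theorem IsGapConfig.onextNbr_ne_self (hc : IsGapConfig c) (hD3 : intruderDist c ^ 2 < 3)
    {i j : Fin 14} (hi0 : i ≠ 0) (hj : j ∈ tightNbrs c i) (h2 : 2 ≤ (tightNbrs c i).card) :
    onextNbr c i j ≠ j := by
  unfold onextNbr
  split_ifs
  · exact hc.nextNbr_ne_self hD3 hi0 hj h2
  · intro h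
    have := hc.nextNbr_prevNbr hD3 hi0 hj
    rw [h] at this
    exact hc.nextNbr_ne_self hD3 hi0 hj h2 this

/-! ## The oriented gap and its per-vertex rows -/

/-- **The oriented gap at vertex `i` following the partner `j`**: the angle at `gapDir c i`
from the arc towards `j` counter-clockwise (seen from outside) to the arc towards
`onextNbr c i j` — `dartGap c i j` in a right-handed frame, the azimuth gap ENDING at `j`
otherwise. -/
def odartGap (c : Fin 14 → EuclideanSpace ℝ (Fin 3)) (i j : Fin 14) : ℝ :=
  if frameDet c i = 1 then dartGap c i j else dartGap c i (prevNbr c i j)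

/-- Oriented gaps are positive. -/
theorem odartGap_pos (c : Fin 14 → EuclideanSpace ℝ (Fin 3)) (i j : Fin 14) : 0 < odartGap c i j := by
  unfold odartGap
  split_ifs <;> exact dartGap_pos c i _

/-- Oriented gaps are at most `2π`. -/
theorem odartGap_le_two_pi (c : Fin 14 → EuclideanSpace ℝ (Fin 3)) (i j : Fin 14) :
    odartGap c i j ≤ 2 * π := by
  unfold odartGap
  split_ifs <;> exact dartGap_le_two_pi c i _

/-- **R-sum for the oriented gaps**: `Σ_{j ∈ tightNbrs c i} odartGap c i j = 2π` at every vertex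
with a partner (admissible, `D² < 3`). -/
theorem IsGapConfig.sum_odartGap (hc : IsGapConfig c) (hD3 : intruderDist c ^ 2 < 3) {i : Fin 14}
    (hi0 : i ≠ 0) (hne : (tightNbrs c i).Nonempty) :
    ∑ j ∈ tightNbrs c i, odartGap c i j = 2 * π := by
  unfold odartGap
  split_ifs with h
  · exact hc.sum_dartGap hD3 hi0 hne
  · rw [← hc.sum_dartGap hD3 hi0 hne]
    refine Finset.sum_nbij (fun j => prevNbr c i j) (fun j hj => hc.prevNbr_mem hD3 hi0 hj)
      ?_ ?_ (fun j _ => rfl)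
    · intro j hj j' hj' hh
      rw [Finset.mem_coe] at hj hj'
      have hh' : prevNbr c i j = prevNbr c i j' := hh
      rw [← hc.nextNbr_prevNbr hD3 hi0 hj, ← hc.nextNbr_prevNbr hD3 hi0 hj', hh']
    · intro j hj
      rw [Finset.mem_coe] at hj
      exact ⟨nextNbr c i j, Finset.mem_coe.2 (hc.nextNbr_mem_tightNbrs hD3 hi0 hj),
        hc.prevNbr_nextNbr hD3 hi0 hj⟩

/-- **An oriented gap of at most `π` is the corner between the partner and the oriented
successor**: `odartGap c i j = corner c i (onextNbr c i j) j` (admissible, `D² < 3`). -/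
theorem IsGapConfig.odartGap_eq_corner (hc : IsGapConfig c) (hD3 : intruderDist c ^ 2 < 3)
    {i j : Fin 14} (hi0 : i ≠ 0) (hj : j ∈ tightNbrs c i) (hle : odartGap c i j ≤ π) :
    odartGap c i j = corner c i (onextNbr c i j) j := by
  unfold odartGap onextNbr at *
  split_ifs at hle ⊢ with h
  · exact hc.dartGap_eq_corner hD3 hi0 hj hle
  · rw [hc.dartGap_eq_corner hD3 hi0 (hc.prevNbr_mem hD3 hi0 hj) hle, hc.nextNbr_prevNbr hD3 hi0 hj,
      corner_comm]

/-- Under the census socket every oriented gap is `< π`. -/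
theorem CensusRows.odartGap_lt_pi (h : CensusRows c) {i j : Fin 14} (hi0 : i ≠ 0)
    (hj : j ∈ tightNbrs c i) : odartGap c i j < π := by
  unfold odartGap
  split_ifs
  · exact h.dartGap_lt_pi hi0 hj
  · exact h.dartGap_lt_pi hi0 (h.isGapConfig.prevNbr_mem h.intruderDist_bounds.1 hi0 hj)

/-- Under the census socket every oriented gap is the corner to the oriented successor. -/
theorem CensusRows.odartGap_eq_corner (h : CensusRows c) {i j : Fin 14} (hi0 : i ≠ 0)
    (hj : j ∈ tightNbrs c i) : odartGap c i j = corner c i (onextNbr c i j) j :=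
  h.isGapConfig.odartGap_eq_corner h.intruderDist_bounds.1 hi0 hj (h.odartGap_lt_pi hi0 hj).le

/-- Under the census socket: R-sum for the oriented gaps. -/
theorem CensusRows.sum_odartGap (h : CensusRows c) {i : Fin 14} (hi0 : i ≠ 0)
    (hne : (tightNbrs c i).Nonempty) : ∑ j ∈ tightNbrs c i, odartGap c i j = 2 * π :=
  h.isGapConfig.sum_odartGap h.intruderDist_bounds.1 hi0 hne

/-- Under the census socket the oriented successor is a different tight partner. -/
theorem CensusRows.onextNbr_mem_ne (h : CensusRows c) {i j : Fin 14} (hi0 : i ≠ 0)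
    (hj : j ∈ tightNbrs c i) : onextNbr c i j ∈ tightNbrs c i ∧ onextNbr c i j ≠ j := by
  obtain ⟨hD3, -, -⟩ := h.intruderDist_bounds
  refine ⟨h.isGapConfig.onextNbr_mem hD3 hi0 hj, h.isGapConfig.onextNbr_ne_self hD3 hi0 hj ?_⟩
  have hset : (univ.filter fun j : Fin 14 => j ≠ 0 ∧ j ≠ i ∧ dist (c i) (c j) = 1) =
      tightNbrs c i := rfl
  by_cases hi13 : i = 13
  · subst hi13
    have h3 := h.three_le_card_intruderContacts
    rw [hset] at h3
    omega
  · have h3 := h.three_le_card_tight i hi0 hi13 ⟨j, mem_tightNbrs.1 hj⟩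
    rw [hset] at h3
    omega

/-! ## Consistency: the oriented successor lies on the positive side -/

/-- `sin` of a position-indexed gap is `sin` of the plain azimuth difference. -/
theorem sin_tightGap (c : Fin 14 → EuclideanSpace ℝ (Fin 3)) (i : Fin 14) {k : ℕ}
    (hd : (tightAngles c i).card = k + 1) (m : Fin (k + 1)) :
    Real.sin (tightGap c i hd m) =
      Real.sin (sortedTightAngle c i hd (finRotate (k + 1) m) - sortedTightAngle c i hd m) := by
  unfold tightGap
  split_ifs
  · rw [Real.sin_add_two_pi]
  · rw [add_zero]

/-- **Orientation consistency.** For an admissible configuration with `intruderDist² < 3`, a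
ball `i ≠ 0` and a tight partner `j` whose oriented gap is `< π`:
`orient3 (gapDir c i) (gapDir c j) (gapDir c (onextNbr c i j)) > 0` — the oriented successor is
on the positive side of the plane spanned by `gapDir c i` and `gapDir c j`. This frame-free
statement is the same at every vertex: `onextNbr` is a consistently oriented rotation system of
the drawn tight graph. -/
theorem IsGapConfig.orient3_onextNbr_pos (hc : IsGapConfig c) (hD3 : intruderDist c ^ 2 < 3)
    {i j : Fin 14} (hi0 : i ≠ 0) (hj : j ∈ tightNbrs c i) (hlt : odartGap c i j < π) :
    0 < orient3 (gapDir c i) (gapDir c j) (gapDir c (onextNbr c i j)) := by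
  have hD1 := hc.one_le_intruderDist
  have hD2 : intruderDist c < 2 := by nlinarith
  obtain ⟨k, hd⟩ := hc.exists_card_tightAngles_eq_succ hD3 hi0 ⟨j, hj⟩
  obtain ⟨m, rfl⟩ := hc.exists_tightNbrAt_eq hD3 hi0 hd hj
  have hj0 := (mem_tightNbrs.1 hj).1
  have hpos := odartGap_pos c i (tightNbrAt c i hd m)
  unfold odartGap onextNbr at *
  split_ifs at hlt hpos ⊢ with h
  · -- right-handed frame: successor = next position, `orient3 = r r' sin(gap) · 1`
    rw [nextNbr_tightNbrAt hd m]
    rw [dartGap_tightNbrAt hd m] at hlt hpos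
    have hn := tightNbrAt_mem c i hd (finRotate (k + 1) m)
    rw [hc.orient3_gapDir hi0 hj0 (mem_tightNbrs.1 hn).1, h, mul_one, tightAzimuth_tightNbrAt,
      tightAzimuth_tightNbrAt, ← sin_tightGap c i hd m]
    exact mul_pos (mul_pos (hc.trad_pos hD2 hi0 hj) (hc.trad_pos hD2 hi0 hn))
      (Real.sin_pos_of_pos_of_lt_pi hpos hlt)
  · -- left-handed frame: successor = previous position, `orient3 = r r' sin(−gap) · (−1)`
    have h' : frameDet c i = -1 := frameDet_eq_neg_one_of_ne h
    rw [prevNbr_tightNbrAt hd m] at hlt hpos ⊢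
    set m' := (finRotate (k + 1)).symm m with hm'
    have hmm' : finRotate (k + 1) m' = m := Equiv.apply_symm_apply _ _
    rw [dartGap_tightNbrAt hd m'] at hlt hpos
    have hn := tightNbrAt_mem c i hd m'
    rw [hc.orient3_gapDir hi0 hj0 (mem_tightNbrs.1 hn).1, h', tightAzimuth_tightNbrAt,
      tightAzimuth_tightNbrAt]
    have hs : Real.sin (sortedTightAngle c i hd m' - sortedTightAngle c i hd m) =
        -Real.sin (tightGap c i hd m') := by
      rw [sin_tightGap c i hd m', hmm', ← Real.sin_neg, neg_sub]
    rw [hs]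
    have := mul_pos (mul_pos (hc.trad_pos hD2 hi0 hj) (hc.trad_pos hD2 hi0 hn))
      (Real.sin_pos_of_pos_of_lt_pi hpos hlt)
    linarith

end Summit.Ventures.Crystal3D
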